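/-
Copyright (c) 2026 the pub-hodgecm-mathlib formalisation cell (harness21).  Prover seat hodgecm-mathlib-A-p03 (g24); LEAD F0P3a-plan (g9) WORD T8-41 «(F4)–(F8) PEN 1»,
architect A-p06 (g26) (MAP v3 §2, LAYER B «=» 03:57:57Z, «(C) coset level» 04:30:10Z), 2026-09-01.
-/
import Literature.NumberTheory.Automorphic.UnitaryThreeDoubleCosetsHKStabilizer
import HarnessLib

/-!
# Flicker's Prop. 10 ∕ Prop. 13, LAYER B CORE: the conjugate `p⁻¹ τ p` for `p ∈ P_H` and its `H^K_m`-membership as congruences in `(uū, x)`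

Topic `NumberTheory/Automorphic` (road «D-N7-inert», MAP v3 (F4)∕(F7) LAYER B; census `F0/P3a/A-p03/g24/CENSUS-F4-F8-FlickerCongruenceVolumes.A-p03g24.md` §4 +
derivation note posted 04:29Z); namespace `Literature.NumberTheory.Automorphic.UnitaryGroup` (B-p17 (g24)'s (F1) frame: `K` with `[Valued K ℤᵐ⁰]`, `σ`, `J = Φ₃`,
`LocalConjDatum σ ϖ`, `unitaryInt σ J`, Flicker's `u_m` ★ `exists_coe_eq_flickerU`, `H^K_m` by congruences ★ `flickerU_inv_mul_mul_flickerU_mem_unitaryInt_iff`).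
THEOREMS ONLY: no definition, no named fact, no instance, no notation, no `sorry`; kernel lane.

THE MATHEMATICS [Flicker1998UnitaryFL, Prop. 10 proof pp. 85–86, in the tree's Φ₃ frame].  An element of Flicker's `P_H · E¹` (Prop. 8 p. 84) is
`p = !![u, 0, u·x; 0, w, 0; 0, 0, (σu)⁻¹]` with `u ∈ R_E^×`, `σx = −x`, `w ∈ E¹`; the torus element conjugated by `r_θ^j` is the literal
`τ = !![A, 0, B₁; 0, b, 0; B₂, 0, A]` (`A = (a+c)∕2`, `B₁ = −(a−c)θ∕2`, `B₂ = −(a−c)θ′∕2`, `θθ′ = 1`; (F0) FILE 2, F0P3-p02 (g11)).  Then (§1)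
`p⁻¹ τ p = !![A − x·ν·B₂, 0, B₁∕ν − x²·ν·B₂; 0, b, 0; ν·B₂, 0, A + x·ν·B₂]`, `ν := u·σu` (Flicker p. 86 l. 3, with his `w ↦ x`, `uū ↦ ν`), and (§2) B-p17's
congruence description of `H^K_m = H ∩ u_m K₀ u_m⁻¹` turns «`p⁻¹ τ p ∈ H^K_m`» into the four valuation conditions
`|νB₂| ≤ 1`, `|A − b + νB₂(1 − x)| ≤ |t|`, `|A − b + νB₂(1 + x)| ≤ |t|`, `|2(A − b) + B₁∕ν + νB₂(1 − x²)| ≤ |t|²` (`t = ϖ^m`) — the «four equations» of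
p. 86 — and (§3) the two symmetric consequences Flicker uses: `|B₂ x| ≤ |t|` («`wπ^ν ≡ 0 (mod π^m)`») and `|A − b + νB₂| ≤ |t|` («`½(a+c) ≡ 1 (mod π^m)`»).
§4 is the REGIME ANALYSIS of Prop. 10 (`j ≥ 1`) as valuation lemmas: «`m > ν` empty» (`v_B₂_le_of_conditions`), «(2)(3) ⟺ `|A−b| ≤ |t|` once `m ≤ ν`»,
«`2m ≤ ν, N₊` ⇒ all solve» (`condition_four_of_le_sq`), «`ν ≠ N₊` beyond ⇒ none» (`not_condition_four_of_ne`), «`ν = N₊ < 2m` ⇒ (4) is the quadratic congruence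
`|B₂|·|n²(1−x²) + dn + ϖ^{2j}| ≤ |t|²`, with a unique unit class `n mod ϖ^{2m−ν}`» (`condition_four_iff_quadratic`, `v_sub_le_of_quadratic`).  The COUNT itself
(Prop. 10's three values ★ `iTen`, over (F3c)'s `P_H ⧸ (P_H ∩ H^K_m)` with the toolkit ★ `LocalFields/UnramifiedQuadraticNormCongruences`) is the sequel
`Rogawski1990/UnitOrbitalIntegralInertCountJPos`.
HONEST LABEL: HC_CM is proved only modulo the printed citations until rung 0 closes; this file is matrix algebra over a valued field.

## References
* [Flicker1998UnitaryFL] Y. Z. Flicker, *Elementary proof of the fundamental lemma for a unitary group*, Canad. J. Math. 50 (1998), 74–98: Prop. 8 p. 84, Prop. 10 pp. 85–86.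
* [Rogawski1990] J. D. Rogawski, *Automorphic Representations of Unitary Groups in Three Variables* (1990), §4.9 p. 55 (the unit orbital integrals being computed).
-/

set_option autoImplicit false

open scoped MatrixGroups WithZero
open Matrix

namespace Literature.NumberTheory.Automorphic

namespace UnitaryGroup

open Literature.NumberTheory.Automorphic.HermitianLattice (unitaryInt mem_unitaryInt_iff LocalConjDatum)

variable {K : Type*} [Field K] [Valued K ℤᵐ⁰] {ϖ : K}
  (σ : K →+* K) {J : Matrix (Fin 3) (Fin 3) K}

/-! ## §1 The conjugate `p⁻¹ τ p` -/

omit [Valued K ℤᵐ⁰] in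
/-- **`p⁻¹ τ p` for `p ∈ P_H·E¹` and `τ` a block torus element** (Flicker p. 86 l. 3, Φ₃ frame): with `p = !![u,0,u·x; 0,w,0; 0,0,(σu)⁻¹]`,
`τ = !![A,0,B₁; 0,b,0; B₂,0,A]` and `ν = u·σu`,
`p⁻¹ τ p = !![A − x ν B₂, 0, B₁ ν⁻¹ − x² ν B₂; 0, b, 0; ν B₂, 0, A + x ν B₂]`. [cite: Flicker1998UnitaryFL, Prop. 10 p. 86] -/
theorem coe_borel_inv_mul_mul_borel {p τ : ↥(unitaryGroupOfForm σ J)} {u x w A B₁ B₂ b : K} (hu : u ≠ 0) (hσu : σ u ≠ 0) (hw : w ≠ 0)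
    (hp : ((p : GL (Fin 3) K) : Matrix (Fin 3) (Fin 3) K) = !![u, 0, u * x; 0, w, 0; 0, 0, (σ u)⁻¹])
    (hτ : ((τ : GL (Fin 3) K) : Matrix (Fin 3) (Fin 3) K) = !![A, 0, B₁; 0, b, 0; B₂, 0, A]) :
    (((p⁻¹ * τ * p : ↥(unitaryGroupOfForm σ J)) : GL (Fin 3) K) : Matrix (Fin 3) (Fin 3) K) =
      !![A - x * (u * σ u) * B₂, 0, B₁ * (u * σ u)⁻¹ - x ^ 2 * (u * σ u) * B₂;
         0, b, 0;
         (u * σ u) * B₂, 0, A + x * (u * σ u) * B₂] := by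
  -- `τ · p = p · R`, then cancel `p` on the left
  have key : ((τ : GL (Fin 3) K) : Matrix (Fin 3) (Fin 3) K) * ((p : GL (Fin 3) K) : Matrix (Fin 3) (Fin 3) K) =
      ((p : GL (Fin 3) K) : Matrix (Fin 3) (Fin 3) K) *
        !![A - x * (u * σ u) * B₂, 0, B₁ * (u * σ u)⁻¹ - x ^ 2 * (u * σ u) * B₂;
           0, b, 0;
           (u * σ u) * B₂, 0, A + x * (u * σ u) * B₂] := by
    rw [hτ, hp]
    simp only [Matrix.mul_fin_three]
    ext i j
    fin_cases i <;> fin_cases j <;> simp only [Matrix.of_apply, Matrix.cons_val', Matrix.cons_val_zero, Matrix.cons_val_one,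
      Matrix.cons_val_fin_one, Matrix.cons_val, Matrix.empty_val', Fin.mk_one, Fin.zero_eta, Fin.reduceFinMk, mul_zero, zero_mul,
      add_zero, zero_add]
    all_goals field_simp
    all_goals ring
  rw [Subgroup.coe_mul, Subgroup.coe_mul, Units.val_mul, Units.val_mul, Matrix.mul_assoc, key, ← Matrix.mul_assoc, Subgroup.coe_inv,
    Units.inv_mul, Matrix.one_mul]

/-! ## §2 `p⁻¹ τ p ∈ H^K_m` as four valuation conditions in `(ν, x)` -/

/-- **«`p⁻¹ τ p ∈ H^K_m`» in coordinates** (`H^K_m = H ∩ u_m K₀ u_m⁻¹`, membership by ★ B-p17's congruences): for `p`, `τ` as in §1 and Flicker's `u_m`,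
`u_m⁻¹ (p⁻¹ τ p) u_m ∈ K₀ ↔ |νB₂| ≤ 1 ∧ |A − b + νB₂(1−x)| ≤ |t| ∧ |A − b + νB₂(1+x)| ≤ |t| ∧ |2(A−b) + B₁ν⁻¹ + νB₂(1−x²)| ≤ |t|²` (`t = ϖ^m`, `ν = uσu`)
— the four equations of Flicker's proof of Prop. 10. [cite: Flicker1998UnitaryFL, Prop. 10 pp. 85–86; Prop. 4 p. 81] -/
theorem borel_conj_mem_unitaryInt_iff (hJ : J = (StdForm.antidiagonal 3).over K) (hd : LocalConjDatum σ ϖ) {y : K} (hy : y * σ y = -2) (m : ℕ)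
    {um p τ : ↥(unitaryGroupOfForm σ J)} {u x w A B₁ B₂ b : K} (hu : u ≠ 0) (hσu : σ u ≠ 0) (hw : w ≠ 0)
    (hum : ((um : GL (Fin 3) K) : Matrix (Fin 3) (Fin 3) K) = !![ϖ ^ m, y, (ϖ ^ m)⁻¹; 0, 1, -σ y * (ϖ ^ m)⁻¹; 0, 0, (ϖ ^ m)⁻¹])
    (hp : ((p : GL (Fin 3) K) : Matrix (Fin 3) (Fin 3) K) = !![u, 0, u * x; 0, w, 0; 0, 0, (σ u)⁻¹])
    (hτ : ((τ : GL (Fin 3) K) : Matrix (Fin 3) (Fin 3) K) = !![A, 0, B₁; 0, b, 0; B₂, 0, A]) :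
    um⁻¹ * (p⁻¹ * τ * p) * um ∈ unitaryInt σ J ↔
      Valued.v ((u * σ u) * B₂) ≤ 1 ∧
      Valued.v (A - b + (u * σ u) * B₂ * (1 - x)) ≤ Valued.v (ϖ ^ m) ∧
      Valued.v (A - b + (u * σ u) * B₂ * (1 + x)) ≤ Valued.v (ϖ ^ m) ∧
      Valued.v (2 * (A - b) + B₁ * (u * σ u)⁻¹ + (u * σ u) * B₂ * (1 - x ^ 2)) ≤ Valued.v (ϖ ^ m) * Valued.v (ϖ ^ m) := by
  have hconj := coe_borel_inv_mul_mul_borel σ hu hσu hw hp hτ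
  rw [flickerU_inv_mul_mul_flickerU_mem_unitaryInt_iff σ hJ hd hy m hum hconj]
  have e2 : A - x * (u * σ u) * B₂ + u * σ u * B₂ - b = A - b + (u * σ u) * B₂ * (1 - x) := by ring
  have e3 : u * σ u * B₂ + (A + x * (u * σ u) * B₂) - b = A - b + (u * σ u) * B₂ * (1 + x) := by ring
  have e4 : A - x * (u * σ u) * B₂ + (B₁ * (u * σ u)⁻¹ - x ^ 2 * (u * σ u) * B₂) + u * σ u * B₂ + (A + x * (u * σ u) * B₂) - 2 * b =
      2 * (A - b) + B₁ * (u * σ u)⁻¹ + (u * σ u) * B₂ * (1 - x ^ 2) := by ring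
  rw [e2, e3, e4]

/-! ## §3 The two symmetric consequences Flicker uses -/

/-- From the two `mod t` conditions: `|B₂·x·ν| ≤ |t|` and `|A − b + νB₂| ≤ |t|` (half-difference and half-sum; `|2| = 1`). In Flicker's words: «considering the entries
(1,1) and (2,2), we deduce that `wπ^ν ≡ 0 (mod π^m)`» and «`½(a+c) ≡ 1 (mod π^m)`» once `m ≤ ν`. [cite: Flicker1998UnitaryFL, Prop. 10 p. 86] -/
theorem v_le_of_two_congruences (h2 : Valued.v (2 : K) = 1) {A b ν B₂ x t : K}
    (h₂ : Valued.v (A - b + ν * B₂ * (1 - x)) ≤ Valued.v t) (h₃ : Valued.v (A - b + ν * B₂ * (1 + x)) ≤ Valued.v t) :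
    Valued.v (ν * B₂ * x) ≤ Valued.v t ∧ Valued.v (A - b + ν * B₂) ≤ Valued.v t := by
  have hdiff : Valued.v ((A - b + ν * B₂ * (1 + x)) - (A - b + ν * B₂ * (1 - x))) ≤ Valued.v t :=
    le_trans (Valuation.map_sub _ _ _) (max_le h₃ h₂)
  have hsum : Valued.v ((A - b + ν * B₂ * (1 + x)) + (A - b + ν * B₂ * (1 - x))) ≤ Valued.v t :=
    le_trans (Valuation.map_add _ _ _) (max_le h₃ h₂)
  have ed : (A - b + ν * B₂ * (1 + x)) - (A - b + ν * B₂ * (1 - x)) = 2 * (ν * B₂ * x) := by ring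
  have es : (A - b + ν * B₂ * (1 + x)) + (A - b + ν * B₂ * (1 - x)) = 2 * (A - b + ν * B₂) := by ring
  rw [ed, map_mul, h2, one_mul] at hdiff
  rw [es, map_mul, h2, one_mul] at hsum
  exact ⟨hdiff, hsum⟩

/-- Conversely, `|B₂·x·ν| ≤ |t|` and `|A − b + νB₂| ≤ |t|` give back the two `mod t` conditions. [cite: Flicker1998UnitaryFL, Prop. 10 p. 86] -/
theorem two_congruences_of_v_le {A b ν B₂ x t : K}
    (hx : Valued.v (ν * B₂ * x) ≤ Valued.v t) (hs : Valued.v (A - b + ν * B₂) ≤ Valued.v t) :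
    Valued.v (A - b + ν * B₂ * (1 - x)) ≤ Valued.v t ∧ Valued.v (A - b + ν * B₂ * (1 + x)) ≤ Valued.v t := by
  have e₁ : A - b + ν * B₂ * (1 - x) = (A - b + ν * B₂) - ν * B₂ * x := by ring
  have e₂ : A - b + ν * B₂ * (1 + x) = (A - b + ν * B₂) + ν * B₂ * x := by ring
  refine ⟨?_, ?_⟩
  · rw [e₁]; exact le_trans (Valuation.map_sub _ _ _) (max_le hs hx)
  · rw [e₂]; exact le_trans (Valuation.map_add _ _ _) (max_le hs hx)

/-! ## §4 The regimes of Prop. 10 (`j ≥ 1`) as valuation lemmas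

Notation for this section: `n := uσu` (a unit), `x` integral with `1 − x²` a unit (automatic for `σx = −x`, `|2| = 1`: `v_one_sub_sq_eq_one`), `B₁ = B₂ ϖ^{2j}`,
`t = ϖ^m`; «(2)(3)(4)» are the last three conditions of §2. -/

/-- `1 − x²` is a unit when `σx = −x`, `x` is integral, `σ` is isometric and `|2| = 1` (`1 − x² = (1+x)(1−x)`, `σ(1+x) = 1−x`, and `(1+x) + (1−x) = 2`).
[cite: Flicker1998UnitaryFL, Prop. 10 p. 86] -/
theorem v_one_sub_sq_eq_one (hσv : ∀ z, Valued.v (σ z) = Valued.v z) (h2 : Valued.v (2 : K) = 1) {x : K} (hσx : σ x = -x)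
    (hx : Valued.v x ≤ 1) : Valued.v (1 - x ^ 2) = 1 := by
  have hfac : (1 : K) - x ^ 2 = (1 + x) * (1 - x) := by ring
  have hσ1x : σ (1 + x) = 1 - x := by rw [map_add, map_one, hσx]; ring
  have hle : Valued.v (1 + x) ≤ 1 := le_trans (Valuation.map_add _ _ _) (max_le (le_of_eq (map_one _)) hx)
  have hle' : Valued.v (1 - x) ≤ 1 := by rw [← hσ1x, hσv]; exact hle
  have hge : 1 ≤ Valued.v (1 + x) := by
    by_contra hlt
    push Not at hlt
    have hlt' : Valued.v (1 - x) < 1 := by rw [← hσ1x, hσv]; exact hlt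
    have : Valued.v ((1 + x) + (1 - x)) < 1 := lt_of_le_of_lt (Valuation.map_add _ _ _) (max_lt hlt hlt')
    rw [show (1 + x) + (1 - x) = (2 : K) by ring, h2] at this
    exact lt_irrefl _ this
  have h1 : Valued.v (1 + x) = 1 := le_antisymm hle hge
  rw [hfac, map_mul, h1, one_mul, ← hσ1x, hσv, h1]

/-- **Regime «`m > ν` is empty»** (Flicker p. 86: «if `m > ν`, considering the entries (1,2) and (2,1) we conclude that `j = 0`»): for `j ≥ 1`, conditions (2)(3)(4) force
`|B₂| ≤ |t|`, i.e. `m ≤ ν`. [cite: Flicker1998UnitaryFL, Prop. 10 p. 86] -/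
theorem v_B₂_le_of_conditions (hd : LocalConjDatum σ ϖ) {A b n B₁ B₂ x : K} {m j : ℕ} (hj : 1 ≤ j) (hB₂ : B₂ ≠ 0)
    (hn : Valued.v n = 1) (hx : Valued.v x ≤ 1) (hB₁ : B₁ = B₂ * ϖ ^ (2 * j))
    (h₂ : Valued.v (A - b + n * B₂ * (1 - x)) ≤ Valued.v (ϖ ^ m)) (h₃ : Valued.v (A - b + n * B₂ * (1 + x)) ≤ Valued.v (ϖ ^ m))
    (h₄ : Valued.v (2 * (A - b) + B₁ * n⁻¹ + n * B₂ * (1 - x ^ 2)) ≤ Valued.v (ϖ ^ m) * Valued.v (ϖ ^ m)) :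
    Valued.v B₂ ≤ Valued.v (ϖ ^ m) := by
  obtain ⟨hxν, hsν⟩ := v_le_of_two_congruences hd.v2 h₂ h₃
  have hn0 : n ≠ 0 := fun h => by rw [h, map_zero] at hn; exact zero_ne_one hn
  have ht1 : Valued.v (ϖ ^ m) ≤ 1 := hd.v_pow_le_one m
  have h₄' : Valued.v (2 * (A - b) + B₁ * n⁻¹ + n * B₂ * (1 - x ^ 2)) ≤ Valued.v (ϖ ^ m) :=
    le_trans h₄ (by simpa using mul_le_mul' ht1 (le_refl (Valued.v (ϖ ^ m))))
  -- `nB₂ = 2(A − b + nB₂) − (nB₂x)·x + B₁n⁻¹ − [the (4)-expression]`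
  have key : n * B₂ = 2 * (A - b + n * B₂) - (n * B₂ * x) * x + B₁ * n⁻¹ - (2 * (A - b) + B₁ * n⁻¹ + n * B₂ * (1 - x ^ 2)) := by ring
  have hvnB₂ : Valued.v (n * B₂) = Valued.v B₂ := by rw [map_mul, hn, one_mul]
  have hB₁v : Valued.v (B₁ * n⁻¹) = Valued.v B₂ * Valued.v (ϖ ^ (2 * j)) := by rw [hB₁, map_mul, map_mul, map_inv₀, hn, inv_one, mul_one]
  have hlt : Valued.v (ϖ ^ (2 * j)) < 1 := by
    rw [hd.v_pow, ← WithZero.exp_zero, WithZero.exp_lt_exp]; omega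
  by_contra hgt
  push Not at hgt
  -- every term on the right of `key` is `< |B₂|`
  have t1 : Valued.v (2 * (A - b + n * B₂)) < Valued.v B₂ := by rw [map_mul, hd.v2, one_mul]; exact lt_of_le_of_lt hsν hgt
  have t2 : Valued.v ((n * B₂ * x) * x) < Valued.v B₂ := by
    rw [map_mul]; exact lt_of_le_of_lt (by simpa using mul_le_mul' hxν hx) hgt
  have hB₂pos : 0 < Valued.v B₂ := (Valuation.pos_iff _).2 hB₂
  have t3 : Valued.v (B₁ * n⁻¹) < Valued.v B₂ := by
    rw [hB₁v]; exact mul_lt_of_lt_one_right hB₂pos hlt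
  have t4 : Valued.v (2 * (A - b) + B₁ * n⁻¹ + n * B₂ * (1 - x ^ 2)) < Valued.v B₂ := lt_of_le_of_lt h₄' hgt
  have : Valued.v (n * B₂) < Valued.v B₂ := by
    rw [key]
    refine lt_of_le_of_lt (Valuation.map_sub _ _ _) (max_lt ?_ t4)
    refine lt_of_le_of_lt (Valuation.map_add _ _ _) (max_lt ?_ t3)
    exact lt_of_le_of_lt (Valuation.map_sub _ _ _) (max_lt t1 t2)
  rw [hvnB₂] at this
  exact lt_irrefl _ this

/-- **Regime `m ≤ ν`: (2)∧(3) ⟺ `|A − b| ≤ |t|`** (then `N₊ ≥ m` is a condition on the data, not on `p`). [cite: Flicker1998UnitaryFL, Prop. 10 p. 86] -/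
theorem two_congruences_iff_of_v_B₂_le {A b n B₂ x : K} {m : ℕ} (hB₂m : Valued.v B₂ ≤ Valued.v (ϖ ^ m))
    (hn : Valued.v n = 1) (hx : Valued.v x ≤ 1) :
    (Valued.v (A - b + n * B₂ * (1 - x)) ≤ Valued.v (ϖ ^ m) ∧ Valued.v (A - b + n * B₂ * (1 + x)) ≤ Valued.v (ϖ ^ m)) ↔
      Valued.v (A - b) ≤ Valued.v (ϖ ^ m) := by
  have h1x : ∀ s : K, Valued.v s ≤ 1 → Valued.v (n * B₂ * s) ≤ Valued.v (ϖ ^ m) := fun s hs => by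
    rw [map_mul, map_mul, hn, one_mul]; simpa using mul_le_mul' hB₂m hs
  have hm : Valued.v (1 - x) ≤ 1 := le_trans (Valuation.map_sub _ _ _) (max_le (le_of_eq (map_one _)) hx)
  have hp : Valued.v (1 + x) ≤ 1 := le_trans (Valuation.map_add _ _ _) (max_le (le_of_eq (map_one _)) hx)
  constructor
  · rintro ⟨h₂, -⟩
    have e : A - b = (A - b + n * B₂ * (1 - x)) - n * B₂ * (1 - x) := by ring
    rw [e]; exact le_trans (Valuation.map_sub _ _ _) (max_le h₂ (h1x _ hm))
  · intro h
    exact ⟨le_trans (Valuation.map_add _ _ _) (max_le h (h1x _ hm)), le_trans (Valuation.map_add _ _ _) (max_le h (h1x _ hp))⟩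

/-- **Regime «everything solves»**: if `|A − b| ≤ |t|²` and `|B₂| ≤ |t|²` (i.e. `2m ≤ N₊`, `2m ≤ ν`) then (4) holds for every unit `n` and integral `x`
(Flicker: «if `m ≤ ν′, ν″`, namely `2m ≤ ν, N₊`, any `u`, `λ₁` make a solution»). [cite: Flicker1998UnitaryFL, Prop. 10 p. 86] -/
theorem condition_four_of_le_sq (hd : LocalConjDatum σ ϖ) {A b n B₁ B₂ x : K} {m j : ℕ}
    (hn : Valued.v n = 1) (hx : Valued.v x ≤ 1) (hB₁ : B₁ = B₂ * ϖ ^ (2 * j))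
    (hs : Valued.v (A - b) ≤ Valued.v (ϖ ^ m) * Valued.v (ϖ ^ m)) (hB₂ : Valued.v B₂ ≤ Valued.v (ϖ ^ m) * Valued.v (ϖ ^ m)) :
    Valued.v (2 * (A - b) + B₁ * n⁻¹ + n * B₂ * (1 - x ^ 2)) ≤ Valued.v (ϖ ^ m) * Valued.v (ϖ ^ m) := by
  have hx2 : Valued.v (1 - x ^ 2) ≤ 1 :=
    le_trans (Valuation.map_sub _ _ _) (max_le (le_of_eq (map_one _)) (by rw [map_pow]; exact pow_le_one' hx 2))
  have t1 : Valued.v (2 * (A - b)) ≤ Valued.v (ϖ ^ m) * Valued.v (ϖ ^ m) := by rw [map_mul, hd.v2, one_mul]; exact hs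
  have t2 : Valued.v (B₁ * n⁻¹) ≤ Valued.v (ϖ ^ m) * Valued.v (ϖ ^ m) := by
    rw [hB₁, map_mul, map_mul, map_inv₀, hn, inv_one, mul_one]
    exact le_trans (by simpa using mul_le_mul' (le_refl (Valued.v B₂)) (hd.v_pow_le_one (2 * j))) hB₂
  have t3 : Valued.v (n * B₂ * (1 - x ^ 2)) ≤ Valued.v (ϖ ^ m) * Valued.v (ϖ ^ m) := by
    rw [map_mul, map_mul, hn, one_mul]; exact le_trans (by simpa using mul_le_mul' (le_refl (Valued.v B₂)) hx2) hB₂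
  exact le_trans (Valuation.map_add _ _ _) (max_le (le_trans (Valuation.map_add _ _ _) (max_le t1 t2)) t3)

/-- **Regime «`ν′ ≠ ν″`, one of them `< m`» has NO solution**: if `|A − b| ≠ |B₂|` and `max(|A − b|, |B₂|) > |t|²` then (4) fails (for `j ≥ 1`, `1 − x²` a unit)
— the valuations `|2(A−b)| = |A−b|`, `|nB₂(1−x²)| = |B₂|`, `|B₁∕n| < |B₂|` cannot cancel. [cite: Flicker1998UnitaryFL, Prop. 10 p. 86] -/
theorem not_condition_four_of_ne (hd : LocalConjDatum σ ϖ) {A b n B₁ B₂ x : K} {m j : ℕ} (hj : 1 ≤ j) (hB₂0 : B₂ ≠ 0)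
    (hn : Valued.v n = 1) (h1x : Valued.v (1 - x ^ 2) = 1) (hB₁ : B₁ = B₂ * ϖ ^ (2 * j))
    (hne : Valued.v (A - b) ≠ Valued.v B₂) (hbig : Valued.v (ϖ ^ m) * Valued.v (ϖ ^ m) < max (Valued.v (A - b)) (Valued.v B₂)) :
    ¬ Valued.v (2 * (A - b) + B₁ * n⁻¹ + n * B₂ * (1 - x ^ 2)) ≤ Valued.v (ϖ ^ m) * Valued.v (ϖ ^ m) := by
  intro h₄
  have vX : Valued.v (2 * (A - b)) = Valued.v (A - b) := by rw [map_mul, hd.v2, one_mul]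
  have vZ : Valued.v (n * B₂ * (1 - x ^ 2)) = Valued.v B₂ := by rw [map_mul, map_mul, hn, h1x, one_mul, mul_one]
  have hlt : Valued.v (ϖ ^ (2 * j)) < 1 := by
    rw [hd.v_pow, ← WithZero.exp_zero, WithZero.exp_lt_exp]; omega
  have hB₂pos : 0 < Valued.v B₂ := (Valuation.pos_iff _).2 hB₂0
  have vY : Valued.v (B₁ * n⁻¹) < Valued.v B₂ := by
    rw [hB₁, map_mul, map_mul, map_inv₀, hn, inv_one, mul_one]
    exact mul_lt_of_lt_one_right hB₂pos hlt
  have hsum : Valued.v (2 * (A - b) + B₁ * n⁻¹ + n * B₂ * (1 - x ^ 2)) = max (Valued.v (A - b)) (Valued.v B₂) := by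
    rcases lt_or_gt_of_ne hne with hlt' | hgt'
    · -- |A − b| < |B₂|: the last term dominates
      rw [max_eq_right hlt'.le]
      have hXY : Valued.v (2 * (A - b) + B₁ * n⁻¹) < Valued.v (n * B₂ * (1 - x ^ 2)) := by
        rw [vZ]; exact lt_of_le_of_lt (Valuation.map_add _ _ _) (max_lt (by rwa [vX]) vY)
      rw [Valuation.map_add_eq_of_lt_right _ hXY, vZ]
    · -- |B₂| < |A − b|: the first term dominates
      rw [max_eq_left hgt'.le]
      have hYZ : Valued.v (B₁ * n⁻¹ + n * B₂ * (1 - x ^ 2)) < Valued.v (2 * (A - b)) := by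
        rw [vX]; exact lt_of_le_of_lt (Valuation.map_add _ _ _) (max_lt (lt_trans vY hgt') (by rwa [vZ]))
      rw [add_assoc, Valuation.map_add_eq_of_lt_left _ hYZ, vX]
  rw [hsum] at h₄
  exact absurd (lt_of_lt_of_le hbig h₄) (lt_irrefl _)

/-- **Regime `ν = N₊ < 2m`: (4) is the QUADRATIC CONGRUENCE in the norm**: `2(A−b) + B₁n⁻¹ + nB₂(1−x²) = (B₂∕n)·(n²(1−x²) + d·n + ϖ^{2j})` with `d = 2(A−b)∕B₂`, so for a unit
`n`, (4) ⟺ `|B₂|·|n²(1−x²) + d n + ϖ^{2j}| ≤ |t|²` (Flicker's `Δ⁻¹(1 + επ^{2j}Δ²)` form, p. 86). [cite: Flicker1998UnitaryFL, Prop. 10 p. 86] -/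
theorem condition_four_iff_quadratic {A b n B₁ B₂ x : K} {m j : ℕ} (hB₂0 : B₂ ≠ 0) (hn : Valued.v n = 1) (hB₁ : B₁ = B₂ * ϖ ^ (2 * j)) :
    Valued.v (2 * (A - b) + B₁ * n⁻¹ + n * B₂ * (1 - x ^ 2)) ≤ Valued.v (ϖ ^ m) * Valued.v (ϖ ^ m) ↔
      Valued.v B₂ * Valued.v (n ^ 2 * (1 - x ^ 2) + (2 * (A - b) / B₂) * n + ϖ ^ (2 * j)) ≤ Valued.v (ϖ ^ m) * Valued.v (ϖ ^ m) := by
  have hn0 : n ≠ 0 := fun h => by rw [h, map_zero] at hn; exact zero_ne_one hn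
  have e : 2 * (A - b) + B₁ * n⁻¹ + n * B₂ * (1 - x ^ 2) = (B₂ * n⁻¹) * (n ^ 2 * (1 - x ^ 2) + (2 * (A - b) / B₂) * n + ϖ ^ (2 * j)) := by
    rw [hB₁]; field_simp; ring
  rw [e, map_mul, map_mul, map_inv₀, hn, inv_one, mul_one]

/-- **Uniqueness of the norm class in the regime `ν = N₊ < 2m`** (Flicker: «`Δ` is uniquely determined modulo `π^{m−ν′}`»): two unit solutions `n₁, n₂` of
`|n²(1−x²) + dn + ϖ^{2j}| ≤ |ϖ^k|` (`k, j ≥ 1`, `1 − x²` a unit) agree modulo `ϖ^k`: `E(n₁) − E(n₂) = (n₁ − n₂)·((n₁+n₂)(1−x²) + d)` and the second factor is a unit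
because `d ≡ −n₁(1−x²) − ϖ^{2j}∕n₁`. [cite: Flicker1998UnitaryFL, Prop. 10 p. 86] -/
theorem v_sub_le_of_quadratic (hd : LocalConjDatum σ ϖ) {n₁ n₂ x d : K} {k j : ℕ} (hk : 1 ≤ k) (hj : 1 ≤ j)
    (hn₁ : Valued.v n₁ = 1) (hn₂ : Valued.v n₂ = 1) (h1x : Valued.v (1 - x ^ 2) = 1)
    (hE₁ : Valued.v (n₁ ^ 2 * (1 - x ^ 2) + d * n₁ + ϖ ^ (2 * j)) ≤ Valued.v (ϖ ^ k))
    (hE₂ : Valued.v (n₂ ^ 2 * (1 - x ^ 2) + d * n₂ + ϖ ^ (2 * j)) ≤ Valued.v (ϖ ^ k)) :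
    Valued.v (n₁ - n₂) ≤ Valued.v (ϖ ^ k) := by
  have hn₁0 : n₁ ≠ 0 := fun h => by rw [h, map_zero] at hn₁; exact zero_ne_one hn₁
  set E₁ := n₁ ^ 2 * (1 - x ^ 2) + d * n₁ + ϖ ^ (2 * j) with hE₁def
  set E₂ := n₂ ^ 2 * (1 - x ^ 2) + d * n₂ + ϖ ^ (2 * j) with hE₂def
  -- the bracket `(n₁+n₂)(1−x²) + d = n₂(1−x²) + (E₁ − ϖ^{2j})/n₁` is a unit
  have hbr : (n₁ + n₂) * (1 - x ^ 2) + d = n₂ * (1 - x ^ 2) + (E₁ - ϖ ^ (2 * j)) * n₁⁻¹ := by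
    rw [hE₁def]; field_simp; ring
  have hk1 : Valued.v (ϖ ^ k) < 1 := by rw [hd.v_pow, ← WithZero.exp_zero, WithZero.exp_lt_exp]; omega
  have hj1 : Valued.v (ϖ ^ (2 * j)) < 1 := by rw [hd.v_pow, ← WithZero.exp_zero, WithZero.exp_lt_exp]; omega
  have hsmall : Valued.v ((E₁ - ϖ ^ (2 * j)) * n₁⁻¹) < 1 := by
    rw [map_mul, map_inv₀, hn₁, inv_one, mul_one]
    exact lt_of_le_of_lt (Valuation.map_sub _ _ _) (max_lt (lt_of_le_of_lt hE₁ hk1) hj1)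
  have hmain : Valued.v (n₂ * (1 - x ^ 2)) = 1 := by rw [map_mul, hn₂, h1x, one_mul]
  have hunit : Valued.v ((n₁ + n₂) * (1 - x ^ 2) + d) = 1 := by
    rw [hbr, Valuation.map_add_eq_of_lt_left _ (by rw [hmain]; exact hsmall), hmain]
  have hfac : E₁ - E₂ = (n₁ - n₂) * ((n₁ + n₂) * (1 - x ^ 2) + d) := by rw [hE₁def, hE₂def]; ring
  have hdiff : Valued.v (E₁ - E₂) ≤ Valued.v (ϖ ^ k) := le_trans (Valuation.map_sub _ _ _) (max_le hE₁ hE₂)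
  rw [hfac, map_mul, hunit, mul_one] at hdiff
  exact hdiff

end UnitaryGroup

end Literature.NumberTheory.Automorphic
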